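import Literature.MathematicalPhysics.QuantumFieldTheory.Federbush1986.LandauModeBondMultipliers
import Mathlib.Analysis.Complex.CauchyIntegral

/-!
# `Federbush1986.MomentumCellContourShift` — [FederbushWilliamson1987PhaseCellII] §III–§IV («We take the analytic extensions of the
# expressions in Sec. II from real p to complex p», «by standard techniques») — THE CONTOUR SHIFT ON THE MOMENTUM CELL: for a `2πℤ⁴`-periodic function analytic and bounded on a tube over the cell,
# `∫_cell H(p) d⁴p = ∫_cell H(p + it e_j) d⁴p`, hence its cell Fourier coefficients decay exponentially:
# `‖∫_cell H(p) e^{ip·m} d⁴p‖ ≤ (2π)⁴ C e^{−t|m_j|}`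

statement-level skeleton of published theorems with citation tags; proofs where landed; nothing here is a claim about the Yang–Mills mass gap

CITATION HEADER.  P. Federbush, C. Williamson, *A phase cell approach to Yang–Mills theory. II. Analysis of a mode*, J. Math. Phys.
**28** (1987) 1416–1419 [FederbushWilliamson1987PhaseCellII] (§III–§IV p. 1417: periodicity (3.1), the tube (3.2)–(3.3), verbatim «We take
the analytic extensions of the expressions in Sec. II from real p to complex p.» and §IV «Equations (3.13)–(3.15) of Ref. 1 follow directly
from Theorems 3.2 and 3.3 of the last section by standard techniques.» — v1.1 DOCFIX, r17 gen 13 quotation audit, declarations untouched: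
the v1 header's «… by standard techniques (such as shifting the domain of integration of ∫d⁴p in x-space [sic] expressions into a complex
domain …)» was a paraphrase — the parenthetical is on no page of the four-page paper; the contour shift is OUR reading of «standard
techniques», with the printed precedent Gawędzki–Kupiainen, Commun. Math. Phys. **77** (1980), Appendix, named by print in §III); P. Federbush, *… I*, Commun. Math. Phys. **107** (1986)
[Federbush1986PhaseCellI] ((3.13) p. 328: exponential decay from analyticity).  Unit `lit-balaban-r17` gen 12 (fold owner of the
Federbush block; own lane `Federbush1986/`), SKELETON rows **F2.Sect§IV** / **F2.Eq3.1-3.5** (the contour-shift technique, here on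
the compact cell with periodic side cancellation instead of decay at infinity — companion of r17 gen 10's `ModeDecayPaleyWiener`
on `ℝ⁴`), **F1.Eq3.2-3.12** (consumer: exponential decay of the bond multipliers of (3.4)/(3.11), next file); heads unchanged.
HOME `run/shared/lean/pub/lit-balaban/`.

THE ARGUMENT (standard).  One variable: for `f` holomorphic on the rectangle `[0, 2π] + i[0, τ]` with `f(2π + iy) = f(iy)`, Cauchy's
theorem on the rectangle (Mathlib's `Complex.integral_boundary_rect_eq_zero_of_differentiableOn`) gives `∫₀^{2π} f(x) dx =
∫₀^{2π} f(x + iτ) dx`, the two vertical sides cancelling by periodicity.  On the cell `[0, 2π)⁴`: Fubini with the coordinate `j`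
innermost (`MeasurableEquiv.piFinSuccAbove`), the one-variable shift along the slice `w ↦ insert_j w q` (the tree's `ModeDecay.sliceC`),
for `G` complex-differentiable on the box-strip `{|Re z_k| < R, |Im z_k| < κ}`, `R > 2π`, and `2π`-periodic in `z_j`.  With
`G = H · e^{iz·m}` and the shift `t·sgn(m_j)`: `|e^{i(p + ite_j)·m}| = e^{−t m_j}`, so `‖∫_cell H e^{ip·m}‖ ≤ vol(cell) · C e^{−t|m_j|}`.

WHAT IS PROVED (kernel-checked; `def`s with bodies; no `Prop`-valued definition, no named fact, no `sorry`).
* §1 **`intervalIntegral_eq_of_periodic`** (one-variable periodic contour shift).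
* §2 `cell3`, `measurableSet_cell3`, `insertNth_mem_cell_iff`, **`setIntegral_cell_eq_iterated`** (`∫_cell F = ∫_{[0,2π)³}∫_{[0,2π)} F(insert_j s q)`).
* §3 `boxStrip`, `differentiable_sliceC'`, `sliceC_mem_boxStrip`, `sliceC_zero_eq_shiftI`, `sliceC_zero_ofReal`, `sliceC_two_pi_add`,
  `shiftI_single_mem_boxStrip`, `continuousOn_shiftI_single`, `integrableOn_cell_shiftI_single`,
  **`setIntegral_cell_shiftI_single`**: `∫_cell G(p) = ∫_cell G(p + it e_j)` (`|t| < κ`).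
* §4 `charC` (`e^{iz·m}`), `charC_shift`, `differentiable_charC`, `charC_toC`, `norm_charC_shiftI_single` (`= e^{−t m_j}`),
  **`norm_setIntegral_cell_mul_cexp_le`**: `‖∫_cell H(p)e^{ip·m} d⁴p‖ ≤ (2π)⁴ C e^{−t|m_j|}` for `H` complex-differentiable and bounded
  by `C` on the box-strip and `2πℤ⁴`-periodic, `0 ≤ t < κ`, every `j`.

HONEST SCOPE.  A general tool (no statement of print is formalised here; print invokes the technique for `∫_{ℝ⁴}`, done in
`ModeDecayPaleyWiener`); the consumer is the decay of the bond multipliers `μ_{(m,ν)} = Re(1/2π)²∫_cell Λ_ν e^{ip·m}` via the analytic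
representative `Λ̃_ν` of `LandauModeMultiplierTube`.  `boxStrip R κ` is definitionally `CorrectedMode.boxTube R κ` of that file
(restated here to keep the two files independent).  Axioms standard.
-/

namespace Literature.MathematicalPhysics.QuantumFieldTheory.Federbush1986

noncomputable section

open Complex ModeAnalyticity Filter Topology MeasureTheory Set
open scoped BigOperators ComplexConjugate FourierTransform RealInnerProductSpace ContDiff Interval

namespace PlaquetteGram

open ModeDecay (toC shiftI sliceC sliceC_eq_shiftI shiftI_re shiftI_im)

/-! ## §1 One variable: the integral over a period is unchanged by a horizontal shift inside the strip of analyticity -/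

/-- **Periodic contour shift in one variable.**  If `f` is complex-differentiable on the closed rectangle `[0, 2π] + i[0, τ]` (or
`i[τ, 0]`) and takes the same values on its two vertical sides (`f(2π + iy) = f(iy)`), then `∫₀^{2π} f(x) dx = ∫₀^{2π} f(x + iτ) dx`
(Cauchy's theorem on the rectangle; the side integrals cancel). [cite: FederbushWilliamson1987PhaseCellII, §III–§IV p. 1417
(«analytic extensions … from real p to complex p», «by standard techniques»)] -/
theorem intervalIntegral_eq_of_periodic {f : ℂ → ℂ} {τ : ℝ}
    (hf : DifferentiableOn ℂ f ([[(0 : ℝ), 2 * Real.pi]] ×ℂ [[(0 : ℝ), τ]]))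
    (hper : ∀ y ∈ [[(0 : ℝ), τ]], f (((2 * Real.pi : ℝ) : ℂ) + (y : ℂ) * I) = f (((0 : ℝ) : ℂ) + (y : ℂ) * I)) :
    ∫ x in (0 : ℝ)..2 * Real.pi, f x = ∫ x in (0 : ℝ)..2 * Real.pi, f ((x : ℂ) + (τ : ℂ) * I) := by
  set w : ℂ := ((2 * Real.pi : ℝ) : ℂ) + (τ : ℂ) * I with hw
  have hw_re : w.re = 2 * Real.pi := by simp [hw]
  have hw_im : w.im = τ := by simp [hw]
  have h := Complex.integral_boundary_rect_eq_zero_of_differentiableOn f 0 w (by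
    rw [Complex.zero_re, Complex.zero_im, hw_re, hw_im]; exact hf)
  rw [Complex.zero_re, Complex.zero_im, hw_re, hw_im] at h
  have hside : ∫ y in (0 : ℝ)..τ, f (((2 * Real.pi : ℝ) : ℂ) + (y : ℂ) * I) = ∫ y in (0 : ℝ)..τ, f (((0 : ℝ) : ℂ) + (y : ℂ) * I) :=
    intervalIntegral.integral_congr fun y hy => hper y hy
  rw [hside] at h
  have h0 : ∫ x in (0 : ℝ)..2 * Real.pi, f ((x : ℂ) + ((0 : ℝ) : ℂ) * I) = ∫ x in (0 : ℝ)..2 * Real.pi, f x := by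
    simp only [Complex.ofReal_zero, zero_mul, add_zero]
  rw [h0] at h
  linear_combination h

/-- The set integral over `[0, 2π)` is the interval integral. [folklore] -/
private theorem setIntegral_Ico_eq_intervalIntegral (g : ℝ → ℂ) :
    ∫ s in Ico (0 : ℝ) (2 * Real.pi), g s = ∫ s in (0 : ℝ)..2 * Real.pi, g s := by
  rw [integral_Ico_eq_integral_Ioo, ← integral_Ioc_eq_integral_Ioo, ← intervalIntegral.integral_of_le Real.two_pi_pos.le]

/-! ## §2 The cell integral with one coordinate singled out -/

/-- The remaining three-dimensional cell `[0, 2π)³`. [cite: FederbushWilliamson1987PhaseCellII, (3.1) p. 1417] -/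
def cell3 : Set (Fin 3 → ℝ) := Set.univ.pi fun _ => Ico 0 (2 * Real.pi)

/-- `cell3` is measurable. [cite: FederbushWilliamson1987PhaseCellII, (3.1) p. 1417] -/
theorem measurableSet_cell3 : MeasurableSet cell3 := MeasurableSet.univ_pi fun _ => measurableSet_Ico

/-- Inserting a coordinate: `insertNth j s q ∈ cell ↔ s ∈ [0, 2π) ∧ q ∈ cell3`. [cite: FederbushWilliamson1987PhaseCellII, (3.1) p. 1417] -/
theorem insertNth_mem_cell_iff (j : Fin 4) (s : ℝ) (q : Fin 3 → ℝ) :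
    j.insertNth s q ∈ cell ↔ s ∈ Ico 0 (2 * Real.pi) ∧ q ∈ cell3 := by
  simp only [cell, cell3, Set.mem_univ_pi]
  constructor
  · intro h
    refine ⟨by simpa using h j, fun k => by simpa using h (j.succAbove k)⟩
  · rintro ⟨hs, hq⟩ k
    refine Fin.succAboveCases j ?_ (fun k' => ?_) k
    · simpa using hs
    · simpa using hq k'

/-- **Fubini on the cell with the coordinate `j` innermost**: `∫_cell F = ∫_{q ∈ [0,2π)³} ∫_{s ∈ [0,2π)} F(insert_j s q)`.
[cite: FederbushWilliamson1987PhaseCellII, (3.1) p. 1417, §IV p. 1417] -/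
theorem setIntegral_cell_eq_iterated (j : Fin 4) {F : (Fin 4 → ℝ) → ℂ} (hF : IntegrableOn F cell) :
    ∫ p in cell, F p = ∫ q in cell3, ∫ s in Ico (0 : ℝ) (2 * Real.pi), F (j.insertNth s q) := by
  set e : ℝ × (Fin 3 → ℝ) ≃ᵐ (Fin 4 → ℝ) := (MeasurableEquiv.piFinSuccAbove (fun _ => ℝ) j).symm with he_def
  have hem : MeasurePreserving e := (volume_preserving_piFinSuccAbove (fun _ : Fin 4 => ℝ) j).symm _
  have he : ∀ s q, e (s, q) = j.insertNth s q := by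
    intro s q
    simp [he_def, MeasurableEquiv.piFinSuccAbove_symm_apply, Fin.insertNthEquiv]
  have hpre : e ⁻¹' cell = Ico (0 : ℝ) (2 * Real.pi) ×ˢ cell3 := by
    ext ⟨s, q⟩
    rw [mem_preimage, he, insertNth_mem_cell_iff, mem_prod]
  have hmp := hem.restrict_preimage_emb e.measurableEmbedding cell
  have hint : Integrable (fun z => F (e z)) ((volume : Measure (ℝ × (Fin 3 → ℝ))).restrict (e ⁻¹' cell)) :=
    (hmp.integrable_comp_emb e.measurableEmbedding).2 hF
  rw [hpre, Measure.volume_eq_prod, ← Measure.prod_restrict] at hint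
  rw [← hem.setIntegral_preimage_emb e.measurableEmbedding F cell, hpre, Measure.volume_eq_prod, ← Measure.prod_restrict,
    integral_prod_symm _ hint]
  simp only [he]

/-! ## §3 The one-coordinate shift of a cell integral into the complex tube -/

/-- The open box-strip `{|Re z_k| < R, |Im z_k| < κ}` (this file's name for the tube over the cell; `= CorrectedMode.boxTube`).
[cite: FederbushWilliamson1987PhaseCellII, (3.2)–(3.3) p. 1417] -/
def boxStrip (R κ : ℝ) : Set Momentum := {z | ∀ k, |(z k).re| < R ∧ |(z k).im| < κ}

/-- The slice map is entire (affine). [cite: FederbushWilliamson1987PhaseCellII, §III p. 1417] -/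
theorem differentiable_sliceC' (i : Fin 4) (q : Fin 3 → ℝ) (τ : Fin 4 → ℝ) : Differentiable ℂ (sliceC i q τ) := by
  refine differentiable_pi.2 fun j => ?_
  refine Fin.succAboveCases i ?_ (fun k => ?_) j
  · simp only [sliceC, Fin.insertNth_apply_same]; exact differentiable_id
  · simp only [sliceC, Fin.insertNth_apply_succAbove]; exact differentiable_const _

/-- The real slice through `q ∈ [0,2π)³` maps the window `|Re w| < R`, `|Im w| < κ` into the box-strip (`2π < R`).
[cite: FederbushWilliamson1987PhaseCellII, §III p. 1417] -/
theorem sliceC_mem_boxStrip (j : Fin 4) {q : Fin 3 → ℝ} (hq : q ∈ cell3) {R κ : ℝ} (hR : 2 * Real.pi < R) (hκ : 0 < κ)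
    {w : ℂ} (hw : |w.re| < R ∧ |w.im| < κ) : sliceC j q 0 w ∈ boxStrip R κ := by
  intro k
  refine Fin.succAboveCases j ?_ (fun k' => ?_) k
  · simpa [sliceC, Fin.insertNth_apply_same] using hw
  · simp only [sliceC, Fin.insertNth_apply_succAbove, Pi.zero_apply, Complex.ofReal_zero, zero_mul, add_zero,
      Complex.ofReal_re, Complex.ofReal_im, abs_zero]
    have h := hq k' (Set.mem_univ _)
    exact ⟨by rw [abs_lt]; constructor <;> linarith [h.1, h.2, Real.pi_pos], hκ⟩

/-- `Pi.single j t = update 0 j t`. [folklore] -/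
private theorem single_eq_update (j : Fin 4) (t : ℝ) : (Pi.single j t : Fin 4 → ℝ) = Function.update (0 : Fin 4 → ℝ) j t := rfl

/-- The slice at `s + it` is the momentum `insert_j s q` shifted by `it` in the coordinate `j`. [cite: FederbushWilliamson1987PhaseCellII, §III p. 1417] -/
theorem sliceC_zero_eq_shiftI (j : Fin 4) (q : Fin 3 → ℝ) (s t : ℝ) :
    sliceC j q 0 ((s : ℂ) + (t : ℂ) * I) = shiftI (j.insertNth s q) (Pi.single j t) := by
  rw [sliceC_eq_shiftI, single_eq_update]

/-- The slice at a real point is the real momentum. [cite: FederbushWilliamson1987PhaseCellII, §III p. 1417] -/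
theorem sliceC_zero_ofReal (j : Fin 4) (q : Fin 3 → ℝ) (s : ℝ) : sliceC j q 0 (s : ℂ) = toC (j.insertNth s q) := by
  have h := sliceC_zero_eq_shiftI j q s 0
  rw [Complex.ofReal_zero, zero_mul, add_zero] at h
  rw [h, Pi.single_zero]
  exact ModeDecay.shiftI_zero _

/-- The slice at `2π + iy` is the `2π e_j`-translate of the slice at `iy`. [cite: FederbushWilliamson1987PhaseCellII, (3.1) p. 1417] -/
theorem sliceC_two_pi_add (j : Fin 4) (q : Fin 3 → ℝ) (y : ℝ) :
    sliceC j q 0 (((2 * Real.pi : ℝ) : ℂ) + (y : ℂ) * I) = shift (sliceC j q 0 (((0 : ℝ) : ℂ) + (y : ℂ) * I)) (Pi.single j 1) := by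
  funext k
  refine Fin.succAboveCases j ?_ (fun k' => ?_) k
  · simp [sliceC, Fin.insertNth_apply_same, shift]
    ring
  · simp [sliceC, Fin.insertNth_apply_succAbove, shift, Fin.succAbove_ne]

/-- A real momentum of the closed cell box shifted by `it e_j` (`|t| < κ`) lies in the box-strip (`2π < R`).
[cite: FederbushWilliamson1987PhaseCellII, §III p. 1417] -/
theorem shiftI_single_mem_boxStrip {R κ : ℝ} (hR : 2 * Real.pi < R) {p : Fin 4 → ℝ}
    (hp : p ∈ Icc (fun _ => (0 : ℝ)) (fun _ => 2 * Real.pi)) (j : Fin 4) {t : ℝ} (ht : |t| < κ) :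
    shiftI p (Pi.single j t) ∈ boxStrip R κ := by
  intro k
  have hκ : 0 < κ := lt_of_le_of_lt (abs_nonneg t) ht
  have h1 := hp.1 k; have h2 := hp.2 k
  simp only at h1 h2
  refine ⟨by rw [shiftI_re, abs_lt]; constructor <;> linarith [Real.pi_pos], ?_⟩
  rw [shiftI_im]
  by_cases hk : k = j
  · subst hk; simpa using ht
  · rw [Pi.single_eq_of_ne hk, abs_zero]; exact hκ

/-- Continuity of `p ↦ G(p + it e_j)` on the closed cell box for `G` continuous on the box-strip. [cite: FederbushWilliamson1987PhaseCellII, §III p. 1417] -/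
theorem continuousOn_shiftI_single {G : Momentum → ℂ} {R κ : ℝ} (hR : 2 * Real.pi < R) (hG : ContinuousOn G (boxStrip R κ))
    (j : Fin 4) {t : ℝ} (ht : |t| < κ) :
    ContinuousOn (fun p : Fin 4 → ℝ => G (shiftI p (Pi.single j t))) (Icc (fun _ => (0 : ℝ)) (fun _ => 2 * Real.pi)) := by
  have hc : Continuous fun p : Fin 4 → ℝ => shiftI p (Pi.single j t) := by
    refine continuous_pi fun k => ?_
    simp only [shiftI]
    fun_prop
  exact hG.comp hc.continuousOn fun p hp => shiftI_single_mem_boxStrip hR hp j ht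

/-- Integrability on the cell of `p ↦ G(p + it e_j)`. [cite: FederbushWilliamson1987PhaseCellII, §III p. 1417] -/
theorem integrableOn_cell_shiftI_single {G : Momentum → ℂ} {R κ : ℝ} (hR : 2 * Real.pi < R)
    (hG : ContinuousOn G (boxStrip R κ)) (j : Fin 4) {t : ℝ} (ht : |t| < κ) :
    IntegrableOn (fun p : Fin 4 → ℝ => G (shiftI p (Pi.single j t))) cell :=
  ((continuousOn_shiftI_single hR hG j ht).integrableOn_compact isCompact_Icc).mono_set cell_subset_Icc

/-- **THE ONE-COORDINATE CONTOUR SHIFT ON THE MOMENTUM CELL.**  Let `G` be complex-differentiable on the box-strip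
`{|Re z_k| < R, |Im z_k| < κ}` (`R > 2π`) and `2π`-periodic in the coordinate `j` (`G(z + 2πe_j) = G(z)`).  Then for `|t| < κ`,
`∫_cell G(p) d⁴p = ∫_cell G(p + it e_j) d⁴p` (Fubini with `j` innermost + the one-variable periodic shift).
[cite: FederbushWilliamson1987PhaseCellII, §III–§IV p. 1417] -/
theorem setIntegral_cell_shiftI_single {G : Momentum → ℂ} {R κ : ℝ} (hR : 2 * Real.pi < R) (hκ : 0 < κ)
    (hG : DifferentiableOn ℂ G (boxStrip R κ)) (j : Fin 4) (hper : ∀ z, G (shift z (Pi.single j 1)) = G z)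
    {t : ℝ} (ht : |t| < κ) :
    ∫ p in cell, G (toC p) = ∫ p in cell, G (shiftI p (Pi.single j t)) := by
  have hGc : ContinuousOn G (boxStrip R κ) := hG.continuousOn
  have h0 : |(0 : ℝ)| < κ := by simpa using hκ
  have hI0 := integrableOn_cell_shiftI_single hR hGc j h0
  simp only [Pi.single_zero, ModeDecay.shiftI_zero] at hI0
  rw [setIntegral_cell_eq_iterated j hI0, setIntegral_cell_eq_iterated j (integrableOn_cell_shiftI_single hR hGc j ht)]
  refine setIntegral_congr_fun measurableSet_cell3 fun q hq => ?_
  -- the one-variable problem along the coordinate `j` through `q`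
  set f : ℂ → ℂ := fun w => G (sliceC j q 0 w) with hf
  have hU : DifferentiableOn ℂ f {w : ℂ | |w.re| < R ∧ |w.im| < κ} := by
    rw [hf]
    exact hG.comp (differentiable_sliceC' j q 0).differentiableOn fun w hw => sliceC_mem_boxStrip j hq hR hκ hw
  have hrect : ([[(0 : ℝ), 2 * Real.pi]] ×ℂ [[(0 : ℝ), t]]) ⊆ {w : ℂ | |w.re| < R ∧ |w.im| < κ} := by
    intro w hw
    rw [Set.uIcc_of_le Real.two_pi_pos.le] at hw
    obtain ⟨⟨h1, h2⟩, h3⟩ := hw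
    refine ⟨by rw [abs_lt]; constructor <;> linarith [Real.pi_pos], ?_⟩
    rcases le_total 0 t with h | h
    · rw [Set.uIcc_of_le h] at h3; rw [abs_lt]; rw [abs_lt] at ht; constructor <;> linarith [h3.1, h3.2]
    · rw [Set.uIcc_of_ge h] at h3; rw [abs_lt]; rw [abs_lt] at ht; constructor <;> linarith [h3.1, h3.2]
  have hshift := intervalIntegral_eq_of_periodic (hU.mono hrect) (fun y _ => by
    show G (sliceC j q 0 _) = G (sliceC j q 0 _)
    rw [sliceC_two_pi_add, hper])
  show ∫ s in Ico (0 : ℝ) (2 * Real.pi), G (toC (j.insertNth s q))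
    = ∫ s in Ico (0 : ℝ) (2 * Real.pi), G (shiftI (j.insertNth s q) (Pi.single j t))
  rw [setIntegral_Ico_eq_intervalIntegral, setIntegral_Ico_eq_intervalIntegral]
  simp_rw [← sliceC_zero_ofReal j q, ← sliceC_zero_eq_shiftI j q]
  exact hshift

/-! ## §4 Exponential decay of the cell Fourier coefficients of a periodic function analytic on a tube -/

/-- The character `e^{iz·m}` on `ℂ⁴`. [cite: FederbushWilliamson1987PhaseCellII, (3.1) p. 1417] -/
def charC (m : Fin 4 → ℤ) (z : Momentum) : ℂ := cexp (I * ∑ k, z k * (m k : ℂ))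

/-- `e^{i(z + 2πn)·m} = e^{iz·m}`. [cite: FederbushWilliamson1987PhaseCellII, (3.1) p. 1417] -/
theorem charC_shift (m n : Fin 4 → ℤ) (z : Momentum) : charC m (shift z n) = charC m z := by
  unfold charC
  have hsum : ∑ k, shift z n k * (m k : ℂ) = ∑ k, z k * (m k : ℂ) + 2 * Real.pi * ∑ k, (n k : ℂ) * (m k : ℂ) := by
    simp only [shift]
    rw [Finset.mul_sum, ← Finset.sum_add_distrib]
    exact Finset.sum_congr rfl fun k _ => by ring
  have : I * ∑ k, shift z n k * (m k : ℂ) = I * ∑ k, z k * (m k : ℂ) + ((∑ k, n k * m k : ℤ) : ℂ) * (2 * Real.pi * I) := by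
    rw [hsum]; push_cast; ring
  rw [this, Complex.exp_add, Complex.exp_int_mul_two_pi_mul_I, mul_one]

/-- `charC` is entire. [cite: FederbushWilliamson1987PhaseCellII, (3.1) p. 1417] -/
theorem differentiable_charC (m : Fin 4 → ℤ) : Differentiable ℂ (charC m) := by
  unfold charC
  exact (Differentiable.fun_sum fun k _ => (differentiable_apply k).mul_const _).const_mul _ |>.cexp

/-- At a real momentum `charC` is the cell character `e^{ip·m}`. [cite: FederbushWilliamson1987PhaseCellII, (3.1) p. 1417] -/
theorem charC_toC (m : Fin 4 → ℤ) (p : Fin 4 → ℝ) : charC m (toC p) = cexp (I * ∑ k, (p k : ℂ) * (m k : ℂ)) := by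
  simp [charC, toC_apply]

/-- `|e^{i(p + ite_j)·m}| = e^{−t m_j}`. [cite: FederbushWilliamson1987PhaseCellII, §IV p. 1417] -/
theorem norm_charC_shiftI_single (m : Fin 4 → ℤ) (p : Fin 4 → ℝ) (j : Fin 4) (t : ℝ) :
    ‖charC m (shiftI p (Pi.single j t))‖ = Real.exp (-(t * m j)) := by
  unfold charC
  rw [Complex.norm_exp]
  congr 1
  simp only [shiftI, Complex.mul_re, Complex.I_re, Complex.I_im, zero_mul, one_mul, zero_sub, Complex.re_sum, Complex.im_sum,
    Complex.mul_im, Complex.add_re, Complex.add_im, Complex.ofReal_re, Complex.ofReal_im, Complex.intCast_re, Complex.intCast_im,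
    mul_zero, add_zero, zero_add, mul_one]
  rw [Finset.sum_eq_single j (fun k _ hk => by rw [Pi.single_eq_of_ne hk]; ring) (fun h => absurd (Finset.mem_univ j) h)]
  simp

/-- **EXPONENTIAL DECAY OF THE CELL FOURIER COEFFICIENTS.**  Let `H` be complex-differentiable on the box-strip `{|Re z_k| < R,
|Im z_k| < κ}` (`R > 2π`, `κ > 0`), bounded by `C` there, and `2πℤ⁴`-periodic.  Then for every `m ∈ ℤ⁴`, every coordinate `j` and
`0 ≤ t < κ`: `‖∫_cell H(p) e^{ip·m} d⁴p‖ ≤ (2π)⁴ C e^{−t|m_j|}` (shift the contour by `it·sgn(m_j) e_j`).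
[cite: FederbushWilliamson1987PhaseCellII, §III–§IV p. 1417; Federbush1986PhaseCellI, (3.13) p. 328 (exponential decay from analyticity)] -/
theorem norm_setIntegral_cell_mul_cexp_le {H : Momentum → ℂ} {R κ C : ℝ} (hR : 2 * Real.pi < R) (hκ : 0 < κ)
    (hH : DifferentiableOn ℂ H (boxStrip R κ)) (hC : ∀ z ∈ boxStrip R κ, ‖H z‖ ≤ C)
    (hper : ∀ z (n : Fin 4 → ℤ), H (shift z n) = H z) (m : Fin 4 → ℤ) (j : Fin 4) {t : ℝ} (ht0 : 0 ≤ t) (ht : t < κ) :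
    ‖∫ p in cell, H (toC p) * cexp (I * ∑ k, (p k : ℂ) * (m k : ℂ))‖ ≤ (2 * Real.pi) ^ 4 * C * Real.exp (-(t * |(m j : ℝ)|)) := by
  set G : Momentum → ℂ := fun z => H z * charC m z with hG
  have hGd : DifferentiableOn ℂ G (boxStrip R κ) := hH.mul (differentiable_charC m).differentiableOn
  have hGper : ∀ z, G (shift z (Pi.single j 1)) = G z := fun z => by
    simp only [hG, hper, charC_shift]
  -- the sign of the shift
  set σ : ℝ := if 0 ≤ m j then t else -t with hσ
  have hσabs : |σ| = t := by rw [hσ]; split_ifs <;> simp [abs_of_nonneg ht0]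
  have hσκ : |σ| < κ := by rw [hσabs]; exact ht
  have hσm : σ * (m j : ℝ) = t * |(m j : ℝ)| := by
    rw [hσ]; split_ifs with h
    · rw [abs_of_nonneg (by exact_mod_cast h)]
    · rw [abs_of_neg (by exact_mod_cast (not_le.mp h))]; ring
  have hshift := setIntegral_cell_shiftI_single hR hκ hGd j hGper hσκ
  have hL : (fun p : Fin 4 → ℝ => H (toC p) * cexp (I * ∑ k, (p k : ℂ) * (m k : ℂ))) = fun p => G (toC p) := by
    funext p; simp only [hG, charC_toC]
  rw [hL, hshift]
  have hbound : ∀ p ∈ (cell : Set (Fin 4 → ℝ)), ‖G (shiftI p (Pi.single j σ))‖ ≤ C * Real.exp (-(t * |(m j : ℝ)|)) := by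
    intro p hp
    rw [hG]
    dsimp only
    rw [norm_mul, norm_charC_shiftI_single, hσm]
    exact mul_le_mul_of_nonneg_right (hC _ (shiftI_single_mem_boxStrip hR (cell_subset_Icc hp) j hσκ)) (Real.exp_pos _).le
  have h := norm_setIntegral_le_of_norm_le_const volume_cell_lt_top hbound
  have hvol : volume.real (cell : Set (Fin 4 → ℝ)) = (2 * Real.pi) ^ 4 := by
    rw [measureReal_def, cell, volume_pi_pi]
    simp only [Real.volume_Ico, sub_zero, Finset.prod_const, Finset.card_univ, Fintype.card_fin]
    rw [ENNReal.toReal_pow, ENNReal.toReal_ofReal Real.two_pi_pos.le]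
  rw [hvol] at h
  linarith

end PlaquetteGram

end

end Literature.MathematicalPhysics.QuantumFieldTheory.Federbush1986
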